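import Summits.BirchSwinnertonDyer.BirchSwinnertonDyer.Theorems.KolyvaginDepthDoorDepthTableSteinWuthrichRows9
import Summits.BirchSwinnertonDyer.BirchSwinnertonDyer.Theorems.KolyvaginDepthDoorDepthTableSteinWuthrichEvenRankBSDQuotient
import Summits.BirchSwinnertonDyer.BirchSwinnertonDyer.Theorems.Rank1ResidualIntModelSurjectivity
import Summits.BirchSwinnertonDyer.Rank1Residual.Additive.PointCountEulerNat
import Literature.NumberTheory.EllipticCurves.GlobalMinimalModelNumberFieldBaseChangeProofs
import Literature.NumberTheory.EllipticCurves.LocalReductionKrausMinimality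
import Literature.NumberTheory.EllipticCurves.SelmerTorsionTwistRestriction
import Literature.NumberTheory.EllipticCurves.ComplexMultiplicationNotSemistable
import HarnessLib

/-!
# Route `KolyvaginDepthDoor`, crux `KolyvaginDepthSupplyKN` (stmt-BirchSwinnertonDyer-22820) —
# DEPTH TABLE v15: the RANK-ONE DATUM of the even-rank row `997b1` at `(p, d_K) = (5, -23)` READ AS ONE BSD-QUOTIENT VALUATION
# (Burungale–Castella–Skinner 2025 Cor. 1.3.1 and Gross–Zagier–Kolyvagin BY NAME on a kernel-certified minimal model of the twist)

Helper file of the lead prover of line `levelone` (kdd-p1 g19; `--supports stmt-BirchSwinnertonDyer-22820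
--as helper`); it closes nothing and BSD is NOT proved by it.

The v13 row of `997b1` (g17, `C997b1.cruxBody_of_twistSelmer`) leaves ONE datum: `#Sel_5(E^{(-23)}/ℚ) ≤ 5` for the Heegner twist
`T = E^{(-23)}`, a curve of analytic rank ONE (root number `−1`; observatory numerics `CERT-TABLE.md`, cert-2 g40: `r_an(T) = 1`,
`#Ш_an(T) = 1.000…`, `5 ∤ c(T)`, `#T(ℚ)_tors = 1` — context only). g18 read the ODD-rank rows through Skinner 2016 Thm. C on the
rank-ZERO twist; this file is the EVEN-rank counterpart: the printed `p`-part of BSD IN ANALYTIC RANK ONE (Burungale–Castella–Skinner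
2025 Cor. 1.3.1: any conductor; non-CM, `p > 3` good ordinary, `E[p]` irreducible, (im)) turns the datum into ONE valuation of ONE
rational number, the BSD quotient `L'(T,1)/(Ω_T·Reg_T)` (`= #Ш_an(T)·Tam(T)/#T(ℚ)_tors²`).

`T` has the GLOBAL MINIMAL MODEL `T₀ = [0, -1, 1, -2821, 55579]` (`Δ(T₀) = 147591781333 = 23^6 · 997`), `ℚ`-isomorphic to the tree's
`E.quadraticTwist (-23)` by `(u, r, s, t) = (1, 8, 0, -1/2)` (`minTwist23_smul_eq`). Kernel certificates (all `decide`): `minTwist23_isElliptic`,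
`minTwist23_isGloballyMinimal` (Silverman's `Δ`-criterion (`Δ` is 12th-power-free)), `minTwist23_intModel`, `minTwist23_card_5` (`#T̃₀(𝔽_5) = 2`, `a_5(T) = 4`: good ORDINARY),
Serre's Prop. 19 witnesses `minTwist23_hasSurjectiveModNGaloisRep_5` (`ρ̄_{T,5}` onto; `T` is additive at ``23``, so Prop. 21 is unavailable),
`minTwist23_not_hasCM` (multiplicative at `997`), `minTwist23_kodairaNeron_5` (`5 ∤ ord_v Δ_T` at multiplicative `v`, hence `5 ∤ Tam(T)`).

* `minTwist23_natCard_selmerGroup_eq_of_bsdQuotient` — **BCS Cor. 1.3.1 + GZK ⟹ the datum.** IF `ord_{s=1} L(T,s) = 1` and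
  `ord_5(L'(T,1)/(Ω_T·Reg_T)) ≤ 0`, THEN `#Sel_5(T/ℚ) = 5` (generic `natCard_selmerGroup_eq_of_rankOne_bsdQuotient_bcs`:
  GZK gives rank `1` and `Ш(T)` finite; BCS gives `ord_5` of the quotient `= ord_5 #Ш(T) + ord_5 Tam(T)`; Kodaira–Néron kills the
  Tamagawa term; so `5 ∤ #Ш(T)`, `Ш(T)[5] = 0`, `#Sel_5 = 5^rank = 5`).
* `natCard_selmerGroup_quadraticTwist_neg23_eq_of_bsdQuotient` — the same transported to `E.quadraticTwist (-23)`
  (`natCard_selmerGroup_eq_of_variableChange`).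
  (`d_K = -23` is an alternative Heegner field of `997b1`; the composition with the crux clause is stated at the field of record.)

So, modulo the named print facts (Stein–Wuthrich 2013 Thm. 1.1, W. Zhang 2014 Lemma 8.4 (1) / Thm. 9.1; Burungale–Castella–Skinner 2025 Cor. 1.3.1; Gross–Zagier–Kolyvagin), the crux
`KolyvaginDepthSupplyKN` holds AT `997b1` as soon as ONE real number — the BSD quotient of the rank-one twist `E^{(-23)}`, rational by
Gross–Zagier — has `5`-adic valuation `≤ 0` [and `ord_{s=1} L(T,s) = 1`]. Per curve; nothing class-wide (the open stub (S♭) is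
untouched); BSD is NOT proved by any of this.

References: [BurungaleCastellaSkinner2025] Cor. 1.3.1 (p. 4); [Darmon2004] Thm. 3.22 (GZK); [Serre1972] §2.8 Prop. 19;
[SerreAbelianLadic1968] IV-23; [Kraus1989] Prop. 2; [SilvermanAEC2009] VII.1 Rem. 1.1, VIII.8, X.4.2, X.5 Cor. 5.4;
[CremonaAlgorithms1997] Table 1 (997b1), §3.2.
-/

set_option linter.dupNamespace false

noncomputable section

open scoped Classical NumberField

namespace Summit.BirchSwinnertonDyer.BirchSwinnertonDyer.Theorems.KolyvaginDepthDoor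

open Literature.NumberTheory.EllipticCurves Literature.NumberTheory.EllipticCurves.ModularForms
  WeierstrassCurve NumberField IsDedekindDomain
open Summit.BirchSwinnertonDyer.BirchSwinnertonDyer.Theorems
open Summit.BirchSwinnertonDyer.BirchSwinnertonDyer.Rank2Observatory
open Summit.BirchSwinnertonDyer.BirchSwinnertonDyer.Rank1Residual
open Summit.BirchSwinnertonDyer.Rank1Residual.Additive

namespace C997b1

/-! ## The minimal model `T₀ = [0, -1, 1, -2821, 55579]` of the twist `997b1^{(-23)}` -/

/-- `T₀ = [0, -1, 1, -2821, 55579]` is an elliptic curve over `ℚ` (`Δ = 147591781333 ≠ 0`, kernel-checked). [folklore] -/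
theorem minTwist23_isElliptic : ((⟨0, -1, 1, -2821, 55579⟩ : WeierstrassCurve ℤ).map (Int.castRingHom ℚ)).IsElliptic := by
  rw [WeierstrassCurve.isElliptic_iff, WeierstrassCurve.map_Δ, isUnit_iff_ne_zero, eq_intCast, Int.cast_ne_zero]
  decide +kernel

/-- **`T₀ = [0, -1, 1, -2821, 55579]` is a GLOBAL MINIMAL model** (unconditional): `Δ(T₀) = 23^6 · 997` is twelfth-power-free
(a prime `q` with `q¹² ∣ Δ` has `q < 9`, and none of those does), so Silverman's `Δ`-criterion
`isGloballyMinimal_baseChange_int_of_finrank_mul_lt_twelve` applies with `k = 11`. [cite: SilvermanAEC2009, VII.1 Remark 1.1 and VIII.8] -/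
theorem minTwist23_isGloballyMinimal : ((⟨0, -1, 1, -2821, 55579⟩ : WeierstrassCurve ℤ).map (Int.castRingHom ℚ)).IsGloballyMinimal := by
  have hbc : (⟨0, -1, 1, -2821, 55579⟩ : WeierstrassCurve ℤ).map (Int.castRingHom ℚ) = (⟨0, -1, 1, -2821, 55579⟩ : WeierstrassCurve ℤ).baseChange ℚ := by
    ext <;> simp [WeierstrassCurve.baseChange, WeierstrassCurve.map]
  rw [hbc]
  refine isGloballyMinimal_baseChange_int_of_finrank_mul_lt_twelve _ ℚ 11 (fun q hq hdvd ↦ ?_)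
    (by rw [Module.finrank_self]; norm_num)
  have hΔ : (⟨0, -1, 1, -2821, 55579⟩ : WeierstrassCurve ℤ).Δ = (147591781333 : ℕ) := by decide +kernel
  rw [hΔ] at hdvd
  have h1 : q ^ 12 ∣ 147591781333 := by exact_mod_cast hdvd
  have hle : q ^ 12 ≤ 147591781333 := Nat.le_of_dvd (by norm_num) h1
  have hqM : q < 9 := by
    by_contra h
    have hM : 9 ^ 12 ≤ q ^ 12 := Nat.pow_le_pow_left (by omega) 12
    norm_num at hM
    omega
  interval_cases q <;> first | (norm_num at hq; done) | exact absurd h1 (by decide +kernel)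

/-- The integral model `[0, -1, 1, -2821, 55579]` is its own `integralModelInt` (globally minimal). [folklore] -/
theorem minTwist23_intModel :
    haveI := minTwist23_isGloballyMinimal;
    integralModelInt ((⟨0, -1, 1, -2821, 55579⟩ : WeierstrassCurve ℤ).map (Int.castRingHom ℚ)) = ⟨0, -1, 1, -2821, 55579⟩ := by
  haveI := minTwist23_isGloballyMinimal
  exact IntModel.integralModelInt_eq_of_map_eq _ rfl

/-- **`T₀` is `ℚ`-isomorphic to the tree's twist `E.quadraticTwist (-23)` of `E = 997b1`** by the change of variables
`(u, r, s, t) = (1, 8, 0, -1/2)`: `(u,r,s,t) • T₀ = ⟨0, d·b₂/4, 0, d²·b₄/2, d³·b₆/4⟩` with `(b₂, b₄, b₆)(E) = (-4, -10, -11)`,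
`d = -23`. [cite: SilvermanAEC2009, X.5 Cor. 5.4] -/
theorem minTwist23_smul_eq :
    (⟨1, (8 : ℚ), (0 : ℚ), -((1 : ℚ) / 2)⟩ : WeierstrassCurve.VariableChange ℚ) •
        ((⟨0, -1, 1, -2821, 55579⟩ : WeierstrassCurve ℤ).map (Int.castRingHom ℚ)) =
      ((⟨0, -1, 1, -5, -3⟩ : WeierstrassCurve ℤ).map (Int.castRingHom ℚ)).quadraticTwist ((-23) : ℚ) := by
  haveI := isElliptic_c997b1
  haveI := isGloballyMinimal_c997b1
  ext <;> simp only [WeierstrassCurve.map_a₁, WeierstrassCurve.map_a₂, WeierstrassCurve.map_a₃,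
      WeierstrassCurve.map_a₄, WeierstrassCurve.map_a₆, WeierstrassCurve.variableChange_a₁,
      WeierstrassCurve.variableChange_a₂, WeierstrassCurve.variableChange_a₃,
      WeierstrassCurve.variableChange_a₄, WeierstrassCurve.variableChange_a₆, WeierstrassCurve.quadraticTwist,
      WeierstrassCurve.b₂, WeierstrassCurve.b₄, WeierstrassCurve.b₆, Units.val_one, inv_one,
      eq_intCast] <;> norm_num

/-- `#T̃₀(𝔽_3) = 5`, i.e. `a_3(T) = -1` (kernel-decided, `ℕ`-arithmetic Euler count). [cite: SilvermanAEC2009, V.2] -/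
theorem minTwist23_card_3 :
    Nat.card (((⟨0, -1, 1, -2821, 55579⟩ : WeierstrassCurve ℤ).map (Int.castRingHom (ZMod 3))).toAffine.Point) = 5 := by
  rw [PointCountNat.natCard_point_map_eq (hℓ := ⟨by norm_num⟩) (by norm_num) 0 (-1) 1 (-2821) 55579
    (by decide +kernel)]
  decide +kernel

/-- `#T̃₀(𝔽_5) = 2`, i.e. `a_5(T) = 4` (kernel-decided, `ℕ`-arithmetic Euler count). [cite: SilvermanAEC2009, V.2] -/
theorem minTwist23_card_5 :
    Nat.card (((⟨0, -1, 1, -2821, 55579⟩ : WeierstrassCurve ℤ).map (Int.castRingHom (ZMod 5))).toAffine.Point) = 2 := by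
  rw [PointCountNat.natCard_point_map_eq (hℓ := ⟨by norm_num⟩) (by norm_num) 0 (-1) 1 (-2821) 55579
    (by decide +kernel)]
  decide +kernel

/-- `#T̃₀(𝔽_29) = 28`, i.e. `a_29(T) = 2` (kernel-decided, `ℕ`-arithmetic Euler count). [cite: SilvermanAEC2009, V.2] -/
theorem minTwist23_card_29 :
    Nat.card (((⟨0, -1, 1, -2821, 55579⟩ : WeierstrassCurve ℤ).map (Int.castRingHom (ZMod 29))).toAffine.Point) = 28 := by
  rw [PointCountNat.natCard_point_map_eq (hℓ := ⟨by norm_num⟩) (by norm_num) 0 (-1) 1 (-2821) 55579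
    (by decide +kernel)]
  decide +kernel

/-- `#T̃₀(𝔽_47) = 54`, i.e. `a_47(T) = -6` (kernel-decided, `ℕ`-arithmetic Euler count). [cite: SilvermanAEC2009, V.2] -/
theorem minTwist23_card_47 :
    Nat.card (((⟨0, -1, 1, -2821, 55579⟩ : WeierstrassCurve ℤ).map (Int.castRingHom (ZMod 47))).toAffine.Point) = 54 := by
  rw [PointCountNat.natCard_point_map_eq (hℓ := ⟨by norm_num⟩) (by norm_num) 0 (-1) 1 (-2821) 55579
    (by decide +kernel)]
  decide +kernel

/-- **`5` is a prime of good ORDINARY reduction for `T`** (`5 ∤ Δ_T`, `a_5(T) = 4 ≢ 0`). [cite: SilvermanAEC2009, VII.5 Prop. 5.1 (a)] -/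
theorem minTwist23_goodOrdinary_5 :
    haveI := minTwist23_isGloballyMinimal;
    haveI := Fact.mk (by norm_num : Nat.Prime 5);
    ((⟨0, -1, 1, -2821, 55579⟩ : WeierstrassCurve ℤ).map (Int.castRingHom ℚ)).HasGoodReductionAtPrime 5 ∧
      ¬ ((5 : ℕ) : ℤ) ∣ ((⟨0, -1, 1, -2821, 55579⟩ : WeierstrassCurve ℤ).map (Int.castRingHom ℚ)).frobeniusTrace 5 := by
  haveI := minTwist23_isGloballyMinimal
  haveI := Fact.mk (by norm_num : Nat.Prime 5)
  exact goodOrdinary_of_intModel_certificate minTwist23_intModel 5 (by decide +kernel) (n := 2) minTwist23_card_5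
    (by decide +kernel)

/-- **`ρ̄_{T,5}` is surjective** (unconditional; `T` is ADDITIVE at the primes of `d_K`, so Serre's Prop. 21 for semistable
curves is unavailable — Serre's Prop. 19 instead, tree theorem `IntModel.hasSurjectiveModNGaloisRep_of_intModel_of_serreWitnesses`):
Frobenius witnesses i) `q = 3`, `a = -1`: `a² − 4q` a non-zero square mod `5`, `a ≢ 0`; ii) `q = 29`, `a = 2`: `a² − 4q` a
non-square, `a ≢ 0`; iii) `q = 47`, `a = -6`: `u = a²/q ≡ 3`, `u ∉ {0,1,2,4}`, `u² − 3u + 1 ≢ 0` — all kernel-decided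
(`a_q(T) = ±a_q(E)`: the Serre conditions are twist-invariant). [cite: Serre1972, §2.8 Prop. 19 and §5.2 (iii)] -/
theorem minTwist23_hasSurjectiveModNGaloisRep_5 :
    haveI := minTwist23_isGloballyMinimal;
    ((⟨0, -1, 1, -2821, 55579⟩ : WeierstrassCurve ℤ).map (Int.castRingHom ℚ)).HasSurjectiveModNGaloisRep (5 : ℕ) := by
  have hi : IsSquare (((((3 : ℕ) : ℤ) + 1 - (5 : ℕ) : ℤ) : ZMod 5) ^ 2 - 4 * ((3 : ℕ) : ZMod 5)) ∧
      ((((3 : ℕ) : ℤ) + 1 - (5 : ℕ) : ℤ) : ZMod 5) ^ 2 - 4 * ((3 : ℕ) : ZMod 5) ≠ 0 ∧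
        ((((3 : ℕ) : ℤ) + 1 - (5 : ℕ) : ℤ) : ZMod 5) ≠ 0 := by
    decide +kernel
  have hii : ¬ IsSquare (((((29 : ℕ) : ℤ) + 1 - (28 : ℕ) : ℤ) : ZMod 5) ^ 2 - 4 * ((29 : ℕ) : ZMod 5)) ∧
      ((((29 : ℕ) : ℤ) + 1 - (28 : ℕ) : ℤ) : ZMod 5) ≠ 0 := by
    decide +kernel
  have hiii : ∃ u : ZMod 5, ((((47 : ℕ) : ℤ) + 1 - (54 : ℕ) : ℤ) : ZMod 5) ^ 2 = u * ((47 : ℕ) : ZMod 5) ∧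
      u ≠ 0 ∧ u ≠ 1 ∧ u ≠ 2 ∧ u ≠ 4 ∧ u ^ 2 - 3 * u + 1 ≠ 0 := ⟨3, by decide +kernel⟩
  haveI := Fact.mk (by norm_num : Nat.Prime 3)
  haveI := Fact.mk (by norm_num : Nat.Prime 5)
  haveI := Fact.mk (by norm_num : Nat.Prime 29)
  haveI := Fact.mk (by norm_num : Nat.Prime 47)
  haveI := minTwist23_isElliptic
  haveI := minTwist23_isGloballyMinimal
  exact IntModel.hasSurjectiveModNGaloisRep_of_intModel_of_serreWitnesses minTwist23_intModel 5 (by norm_num) 3 29 47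
    (by norm_num) (by norm_num) (by norm_num) (by decide +kernel) (by decide +kernel) (by decide +kernel)
    (n₁ := 5) (n₂ := 28) (n₃ := 54) minTwist23_card_3 minTwist23_card_29 minTwist23_card_47 hi hii hiii

/-- **`T` is not CM** (multiplicative reduction at `997`: `997 ∣ Δ_T`, `997 ∤ c₄(T) = 135424`; a CM curve has integral `j`).
[cite: SilvermanATAEC1994, Thm. II.6.4 (PDF p. 148)] -/
theorem minTwist23_not_hasCM :
    haveI := minTwist23_isElliptic;
    ¬ ((⟨0, -1, 1, -2821, 55579⟩ : WeierstrassCurve ℤ).map (Int.castRingHom ℚ)).HasCM := by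
  haveI := minTwist23_isElliptic
  haveI := minTwist23_isGloballyMinimal
  haveI := Fact.mk (by norm_num : Nat.Prime 997)
  intro hCM
  exact not_hasMultiplicativeReductionAtPrime_of_hasCM _ hCM 997
    (IntModel.hasMultiplicativeReductionAtPrime_of_intModel minTwist23_intModel 997 (by decide +kernel)
      (by decide +kernel))

/-- **Kodaira–Néron for `T` at `5`**: `5 ∤ ord_v(Δ_T)` at every multiplicative place (`|Δ_T| < 172^5`; prime-power
factorisation `23^6`, `997^1`, read by the table `not_dvd_ordMinimalDiscriminant_of_intModel_table` with the
exponents supplied by hand from the factorisation). Hence `5 ∤ Tam(T)` (`not_dvd_tamagawaProduct_of_kodairaNeron`: `c_v ≤ 4 < 5` at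
additive `v`). [cite: SilvermanAEC2009, VII.5.1, VIII.8, C.15 Table 15.1] -/
theorem minTwist23_kodairaNeron_5 :
    haveI := minTwist23_isElliptic; haveI := minTwist23_isGloballyMinimal;
    ∀ v : HeightOneSpectrum (𝓞 ℚ),
      ((⟨0, -1, 1, -2821, 55579⟩ : WeierstrassCurve ℤ).map (Int.castRingHom ℚ)).HasMultiplicativeReductionAt v →
      ¬ 5 ∣ ((⟨0, -1, 1, -2821, 55579⟩ : WeierstrassCurve ℤ).map (Int.castRingHom ℚ)).ordMinimalDiscriminant v := by
  haveI := minTwist23_isElliptic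
  haveI := minTwist23_isGloballyMinimal
  exact not_dvd_ordMinimalDiscriminant_of_intModel_table minTwist23_intModel (p := 5) (Δ₀ := 147591781333)
    (by decide +kernel) (B := 172) (by decide +kernel)
    (by
      intro q hq hqP hqd
      have hn : ((147591781333 : ℤ).natAbs) = 23 ^ 6 * (997 ^ 1) := by norm_num
      rw [hn] at hqd ⊢
      rcases (Nat.Prime.dvd_mul hqP).mp hqd with h | h0
      · obtain rfl := (Nat.prime_dvd_prime_iff_eq hqP (by norm_num)).mp (hqP.dvd_of_dvd_pow h)
        exact ⟨6, by simp, by decide +kernel, by decide +kernel, by norm_num⟩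
      · obtain rfl := (Nat.prime_dvd_prime_iff_eq hqP (by norm_num)).mp (hqP.dvd_of_dvd_pow h0)
        exact absurd (Finset.mem_range.mp hq) (by norm_num)
      )

/-! ## The rank-one datum as a BSD-quotient valuation (BCS 2025 Cor. 1.3.1, GZK, by name) -/

/-- **THE RANK-ONE DATUM OF THE `997b1` ROW AT `d_K = -23` AS ONE BSD-QUOTIENT VALUATION (Burungale–Castella–Skinner 2025
Cor. 1.3.1 + GZK by name).** For the Heegner twist `T = 997b1^{(-23)}` (minimal model `T₀ = [0, -1, 1, -2821, 55579]`): IF `ord_{s=1} L(T,s) = 1`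
and the rational number `L'(T,1)/(Ω_T·Reg_T)` has `ord_5 ≤ 0`, THEN `#Sel_5(T/ℚ) = 5`. Chain (generic
`natCard_selmerGroup_eq_of_rankOne_bsdQuotient_bcs`): GZK (`hGZK`): rank `T = 1`, `Ш(T)` finite; BCS Cor. 1.3.1 (`hBCS`; non-CM, good
ordinary `5`, `ρ̄_{T,5}` onto ⟹ `T[5]` irreducible and (im)): `ord_5(L'(T,1)/(Ω_T Reg_T)) = ord_5 #Ш(T) + ord_5 Tam(T)`;
Kodaira–Néron: `5 ∤ Tam(T)`; so `5 ∤ #Ш(T)`, `Ш(T)[5] = 0`, `#Sel_5(T) = 5^{rank T} = 5`. CONDITIONAL on the two named facts;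
per curve; BSD is not proved by it. [cite: BurungaleCastellaSkinner2025, Cor. 1.3.1 (p. 4)] [cite: Darmon2004, Thm. 3.22]
[cite: SilvermanAEC2009, Thm. X.4.2] -/
theorem minTwist23_natCard_selmerGroup_eq_of_bsdQuotient
    (hBCS : BurungaleCastellaSkinner2025.cor131_padicValRat_bsd_rank_le_one) (hGZK : rank_eq_analyticRank_of_analyticRank_le_one)
    (hr : haveI := minTwist23_isElliptic;
      ((⟨0, -1, 1, -2821, 55579⟩ : WeierstrassCurve ℤ).map (Int.castRingHom ℚ)).analyticRank = 1)
    (hval : haveI := minTwist23_isElliptic; haveI := minTwist23_isGloballyMinimal;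
      ∀ q : ℚ, ((⟨0, -1, 1, -2821, 55579⟩ : WeierstrassCurve ℤ).map (Int.castRingHom ℚ)).leadingLCoeff /
          (((((⟨0, -1, 1, -2821, 55579⟩ : WeierstrassCurve ℤ).map (Int.castRingHom ℚ)).realPeriodRat *
              ((⟨0, -1, 1, -2821, 55579⟩ : WeierstrassCurve ℤ).map (Int.castRingHom ℚ)).regulator : ℝ)) : ℂ) = (q : ℂ) →
        padicValRat 5 q ≤ 0) :
    haveI := minTwist23_isElliptic;
    Nat.card (((⟨0, -1, 1, -2821, 55579⟩ : WeierstrassCurve ℤ).map (Int.castRingHom ℚ)).selmerGroup (5 : ℕ)) = 5 := by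
  haveI := minTwist23_isElliptic
  haveI := minTwist23_isGloballyMinimal
  haveI := Fact.mk (by norm_num : Nat.Prime 5)
  exact natCard_selmerGroup_eq_of_rankOne_bsdQuotient_bcs hBCS hGZK _ 5 (by norm_num) minTwist23_not_hasCM
    minTwist23_goodOrdinary_5.1 minTwist23_goodOrdinary_5.2 minTwist23_hasSurjectiveModNGaloisRep_5 minTwist23_kodairaNeron_5
    hr hval

/-- **The same datum on the tree's twist `E.quadraticTwist (-23)`** (`E = 997b1`): under the two rank-one hypotheses,
`#Sel_5(E^{(-23)}/ℚ) = 5` — transported along the `ℚ`-isomorphism `minTwist23_smul_eq` (`natCard_selmerGroup_eq_of_variableChange`):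
the hypothesis `hT : #Sel_5(E^{(d_K)}) ≤ 5` of `C997b1.cruxBody_of_twistSelmer` for every `K` with `d_K = -23`. CONDITIONAL on
BCS Cor. 1.3.1 and GZK by name; per curve; BSD is not proved by it. [cite: BurungaleCastellaSkinner2025, Cor. 1.3.1 (p. 4)]
[cite: Darmon2004, Thm. 3.22] [cite: SilvermanAEC2009, X.§4] -/
theorem natCard_selmerGroup_quadraticTwist_neg23_eq_of_bsdQuotient
    (hBCS : BurungaleCastellaSkinner2025.cor131_padicValRat_bsd_rank_le_one) (hGZK : rank_eq_analyticRank_of_analyticRank_le_one)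
    (hr : haveI := minTwist23_isElliptic;
      ((⟨0, -1, 1, -2821, 55579⟩ : WeierstrassCurve ℤ).map (Int.castRingHom ℚ)).analyticRank = 1)
    (hval : haveI := minTwist23_isElliptic; haveI := minTwist23_isGloballyMinimal;
      ∀ q : ℚ, ((⟨0, -1, 1, -2821, 55579⟩ : WeierstrassCurve ℤ).map (Int.castRingHom ℚ)).leadingLCoeff /
          (((((⟨0, -1, 1, -2821, 55579⟩ : WeierstrassCurve ℤ).map (Int.castRingHom ℚ)).realPeriodRat *
              ((⟨0, -1, 1, -2821, 55579⟩ : WeierstrassCurve ℤ).map (Int.castRingHom ℚ)).regulator : ℝ)) : ℂ) = (q : ℂ) →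
        padicValRat 5 q ≤ 0) :
    haveI := isElliptic_c997b1;
    haveI := isGloballyMinimal_c997b1;
    Nat.card ((((⟨0, -1, 1, -5, -3⟩ : WeierstrassCurve ℤ).map (Int.castRingHom ℚ)).quadraticTwist ((-23) : ℚ)).selmerGroup (5 : ℕ)) = 5 := by
  haveI := isElliptic_c997b1
  haveI := isGloballyMinimal_c997b1
  rw [← natCard_selmerGroup_eq_of_variableChange ((5 : ℕ) : ℤ) minTwist23_smul_eq]
  exact minTwist23_natCard_selmerGroup_eq_of_bsdQuotient hBCS hGZK hr hval

end C997b1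

end Summit.BirchSwinnertonDyer.BirchSwinnertonDyer.Theorems.KolyvaginDepthDoor

end
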